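import Mathlib
import HarnessLib

/-!
# Crux `MatrixDescartes` (stmt-ValiantsHypothesis-18050, the summit's V1), line
# `Cruxes/MatrixDescartes/Lines/lorentzian_shadow.lean`, toward the KNOWN stub `stub_detLorentzian` —
# [M3] RADO'S THEOREM (independent transversals) for finite vector families

HONEST FRAMING.  Helper (`--supports stmt-ValiantsHypothesis-18050 --as helper`; merged desk, CLAIM-FIRST #4 of
val-lit-p7 g10, 2026-08-28) on a registered ALTERNATIVE line of V1; reusable linear algebra, 0 definitions /
0 named facts.  It is the sufficiency engine for clause (c) (M-convex support of `detArray`): with [M2]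
(`…RankNecessity.lean`) and [M1] (`…PolymatroidExchange.lean`) the assembly of (c) is the next file.
`stub_detLorentzian` (clause (d)), the law stubs, `MatrixDescartes`, Conjecture B and `VP ≠ VNP` are OPEN.

* `finrank_span_image_mono`, `finrank_span_image_submodular` — the rank function `X ↦ dim span v(X)`.
* `linearIndependent_of_card_le_finrank` — `n ≤ dim span (range (v ∘ g))` forces independence of `v ∘ g`.
* `rado_shrink` — Halmos–Vaughan shrinking step: under Rado's condition `|J| ≤ dim span v(⋃_{j∈J} E j)` one of
  two distinct elements of a set `E i` can be deleted keeping the condition (submodularity).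
* **`rado_linearIndependent_transversal`** — Rado's theorem: the condition yields `g` with `g i ∈ E i` and
  `v ∘ g` linearly independent (induction on `Σ |E i|`).
[Rado, "A theorem on independence relations", Quart. J. Math. Oxford 13 (1942) 83–89; Welsh, Matroid Theory
(1976), Ch. 7; proof after Halmos–Vaughan (1950); folklore]
-/

set_option linter.dupNamespace false
set_option autoImplicit false

namespace Summit.ValiantsHypothesis.ValiantsHypothesis.Theorems.LacunarySymmetroidMatrixDescartes

namespace DetLorentzian

open Finset Module Submodule

variable {𝕜 : Type*} [Field 𝕜] {V : Type*} [AddCommGroup V] [Module 𝕜 V] [FiniteDimensional 𝕜 V]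
variable {ρ : Type*} [DecidableEq ρ]

omit [DecidableEq ρ] in
/-- The rank function `X ↦ dim span (v '' X)` is monotone. [folklore] -/
theorem finrank_span_image_mono (v : ρ → V) {X Y : Finset ρ} (h : X ⊆ Y) :
    finrank 𝕜 (span 𝕜 (v '' (X : Set ρ))) ≤ finrank 𝕜 (span 𝕜 (v '' (Y : Set ρ))) :=
  Submodule.finrank_mono (span_mono (Set.image_mono (Finset.coe_subset.2 h)))

/-- The rank function `X ↦ dim span (v '' X)` is submodular. [folklore] -/
theorem finrank_span_image_submodular (v : ρ → V) (X Y : Finset ρ) :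
    finrank 𝕜 (span 𝕜 (v '' ((X ∪ Y : Finset ρ) : Set ρ))) + finrank 𝕜 (span 𝕜 (v '' ((X ∩ Y : Finset ρ) : Set ρ)))
      ≤ finrank 𝕜 (span 𝕜 (v '' (X : Set ρ))) + finrank 𝕜 (span 𝕜 (v '' (Y : Set ρ))) := by
  rw [Finset.coe_union, Set.image_union, Submodule.span_union]
  have hle : span 𝕜 (v '' ((X ∩ Y : Finset ρ) : Set ρ)) ≤ span 𝕜 (v '' (X : Set ρ)) ⊓ span 𝕜 (v '' (Y : Set ρ)) :=
    le_inf (span_mono (Set.image_mono (Finset.coe_subset.2 inter_subset_left)))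
      (span_mono (Set.image_mono (Finset.coe_subset.2 inter_subset_right)))
  have h1 := Submodule.finrank_mono hle
  have h2 := Submodule.finrank_sup_add_finrank_inf_eq (span 𝕜 (v '' (X : Set ρ))) (span 𝕜 (v '' (Y : Set ρ)))
  omega

omit [FiniteDimensional 𝕜 V] [DecidableEq ρ] in
/-- Singleton families: if every `E i = {g i}` and Rado's condition holds for `J = univ`, then `v ∘ g` is
linearly independent. [folklore] -/
theorem linearIndependent_of_card_le_finrank {n : ℕ} (v : ρ → V) (g : Fin n → ρ)
    (h : n ≤ finrank 𝕜 (span 𝕜 (Set.range (v ∘ g)))) : LinearIndependent 𝕜 (v ∘ g) := by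
  rw [linearIndependent_iff_card_eq_finrank_span, Fintype.card_fin]
  have h2 : Set.finrank 𝕜 (Set.range (v ∘ g)) ≤ n := by
    simpa using finrank_range_le_card (R := 𝕜) (v ∘ g)
  exact le_antisymm h h2

/-- **Rado's theorem (1942) for vector families — the shrinking step (Halmos–Vaughan).**  If Rado's condition
`|J| ≤ dim span v(E(J))` holds and `x₁ ≠ x₂` lie in `E i`, then the condition still holds after deleting `x₁`
from `E i` or after deleting `x₂` from `E i` (submodularity of the rank function). [Rado, "A theorem on
independence relations", Quart. J. Math. 13 (1942); folklore] -/
theorem rado_shrink {n : ℕ} (v : ρ → V) (E : Fin n → Finset ρ)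
    (h : ∀ J : Finset (Fin n), J.card ≤ finrank 𝕜 (span 𝕜 (v '' ((J.biUnion E : Finset ρ) : Set ρ))))
    (i : Fin n) {x₁ x₂ : ρ} (hx₁ : x₁ ∈ E i) (hx₂ : x₂ ∈ E i) (hne : x₁ ≠ x₂) :
    (∀ J : Finset (Fin n), J.card ≤
        finrank 𝕜 (span 𝕜 (v '' ((J.biUnion (Function.update E i ((E i).erase x₁)) : Finset ρ) : Set ρ)))) ∨
    (∀ J : Finset (Fin n), J.card ≤
        finrank 𝕜 (span 𝕜 (v '' ((J.biUnion (Function.update E i ((E i).erase x₂)) : Finset ρ) : Set ρ)))) := by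
  classical
  -- a violating `J` must contain `i`
  have key : ∀ (x : ρ) (J : Finset (Fin n)),
      finrank 𝕜 (span 𝕜 (v '' ((J.biUnion (Function.update E i ((E i).erase x)) : Finset ρ) : Set ρ))) < J.card →
      i ∈ J := by
    intro x J hJ
    by_contra hi
    have heq : J.biUnion (Function.update E i ((E i).erase x)) = J.biUnion E :=
      Finset.biUnion_congr rfl fun j hj => by
        rw [Function.update_of_ne (ne_of_mem_of_not_mem hj hi)]
    rw [heq] at hJ
    exact absurd (h J) (not_le.2 hJ)
  by_contra hcon
  rw [not_or] at hcon
  obtain ⟨h1, h2⟩ := hcon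
  push Not at h1 h2
  obtain ⟨J₁, hJ₁⟩ := h1
  obtain ⟨J₂, hJ₂⟩ := h2
  have hi₁ : i ∈ J₁ := key x₁ J₁ hJ₁
  have hi₂ : i ∈ J₂ := key x₂ J₂ hJ₂
  set X₁ : Finset ρ := J₁.biUnion (Function.update E i ((E i).erase x₁)) with hX₁
  set X₂ : Finset ρ := J₂.biUnion (Function.update E i ((E i).erase x₂)) with hX₂
  set J₁' := J₁.erase i with hJ₁'
  set J₂' := J₂.erase i with hJ₂'
  -- (1) the union covers `E` over `insert i (J₁' ∪ J₂')`
  have hsubU : (insert i (J₁' ∪ J₂')).biUnion E ⊆ X₁ ∪ X₂ := by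
    intro y hy
    rw [Finset.mem_biUnion] at hy
    obtain ⟨j, hj, hyj⟩ := hy
    rw [Finset.mem_union, hX₁, hX₂, Finset.mem_biUnion, Finset.mem_biUnion]
    rcases Finset.mem_insert.1 hj with rfl | hj'
    · by_cases hy1 : y = x₁
      · subst hy1
        refine Or.inr ⟨j, hi₂, ?_⟩
        rw [Function.update_self]
        exact Finset.mem_erase.2 ⟨hne, hyj⟩
      · refine Or.inl ⟨j, hi₁, ?_⟩
        rw [Function.update_self]
        exact Finset.mem_erase.2 ⟨hy1, hyj⟩
    · rcases Finset.mem_union.1 hj' with hj₁ | hj₂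
      · have hji : j ≠ i := Finset.ne_of_mem_erase hj₁
        refine Or.inl ⟨j, Finset.mem_of_mem_erase hj₁, ?_⟩
        rw [Function.update_of_ne hji]; exact hyj
      · have hji : j ≠ i := Finset.ne_of_mem_erase hj₂
        refine Or.inr ⟨j, Finset.mem_of_mem_erase hj₂, ?_⟩
        rw [Function.update_of_ne hji]; exact hyj
  -- (2) the intersection covers `E` over `J₁' ∩ J₂'`
  have hsubI : (J₁' ∩ J₂').biUnion E ⊆ X₁ ∩ X₂ := by
    intro y hy
    rw [Finset.mem_biUnion] at hy
    obtain ⟨j, hj, hyj⟩ := hy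
    obtain ⟨hj₁, hj₂⟩ := Finset.mem_inter.1 hj
    have hji : j ≠ i := Finset.ne_of_mem_erase hj₁
    rw [Finset.mem_inter, hX₁, hX₂, Finset.mem_biUnion, Finset.mem_biUnion]
    exact ⟨⟨j, Finset.mem_of_mem_erase hj₁, by rw [Function.update_of_ne hji]; exact hyj⟩,
      ⟨j, Finset.mem_of_mem_erase hj₂, by rw [Function.update_of_ne hji]; exact hyj⟩⟩
  have hU := (h (insert i (J₁' ∪ J₂'))).trans (finrank_span_image_mono (𝕜 := 𝕜) v hsubU)
  have hI := (h (J₁' ∩ J₂')).trans (finrank_span_image_mono (𝕜 := 𝕜) v hsubI)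
  have hsm := finrank_span_image_submodular (𝕜 := 𝕜) v X₁ X₂
  have hcardU : (insert i (J₁' ∪ J₂')).card = (J₁' ∪ J₂').card + 1 :=
    Finset.card_insert_of_notMem (by simp [hJ₁', hJ₂'])
  have hc₁ : J₁.card = J₁'.card + 1 := (Finset.card_erase_add_one hi₁).symm
  have hc₂ : J₂.card = J₂'.card + 1 := (Finset.card_erase_add_one hi₂).symm
  have hui := Finset.card_union_add_card_inter J₁' J₂'
  omega

/-- **Rado's theorem for finite vector families** (independent transversals): if `E : Fin n → Finset ρ` and
`v : ρ → V` satisfy `|J| ≤ dim span v(⋃_{j∈J} E j)` for every `J`, then there is a choice `g i ∈ E i` with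
`v ∘ g` linearly independent.  Proof: shrink the sets one element at a time (`rado_shrink`) down to singletons.
[Rado, Quart. J. Math. 13 (1942) 83–89; Welsh, Matroid Theory, Ch. 7; folklore] -/
theorem rado_linearIndependent_transversal {n : ℕ} (v : ρ → V) (E : Fin n → Finset ρ)
    (h : ∀ J : Finset (Fin n), J.card ≤ finrank 𝕜 (span 𝕜 (v '' ((J.biUnion E : Finset ρ) : Set ρ)))) :
    ∃ g : Fin n → ρ, (∀ i, g i ∈ E i) ∧ LinearIndependent 𝕜 (v ∘ g) := by
  classical
  -- induction on the total size of the family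
  suffices H : ∀ (N : ℕ) (E : Fin n → Finset ρ), ∑ i, (E i).card ≤ N →
      (∀ J : Finset (Fin n), J.card ≤ finrank 𝕜 (span 𝕜 (v '' ((J.biUnion E : Finset ρ) : Set ρ)))) →
      ∃ g : Fin n → ρ, (∀ i, g i ∈ E i) ∧ LinearIndependent 𝕜 (v ∘ g) from H _ E le_rfl h
  intro N
  induction N with
  | zero =>
    intro E hN hE
    -- all sets empty: only possible for `n = 0`
    rcases Nat.eq_zero_or_pos n with hn | hn
    · subst hn
      exact ⟨fun i => Fin.elim0 i, fun i => Fin.elim0 i, linearIndependent_empty_type⟩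
    · exfalso
      have h0 : (E ⟨0, hn⟩).card = 0 := by
        have := Finset.single_le_sum (fun j _ => Nat.zero_le ((E j).card)) (Finset.mem_univ (⟨0, hn⟩ : Fin n))
        omega
      have h1 := hE {⟨0, hn⟩}
      rw [Finset.card_singleton, Finset.singleton_biUnion, Finset.card_eq_zero.1 h0] at h1
      simp at h1
  | succ N ih =>
    intro E hN hE
    by_cases hall : ∀ i, (E i).card = 1
    · -- singleton family: read off the transversal
      have hg : ∀ i, ∃ a, E i = {a} := fun i => Finset.card_eq_one.1 (hall i)
      choose g hg using hg
      refine ⟨g, fun i => by rw [hg i]; exact Finset.mem_singleton_self _, ?_⟩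
      apply linearIndependent_of_card_le_finrank
      have hu := hE univ
      rw [Finset.card_univ, Fintype.card_fin] at hu
      have hS : v '' ((univ.biUnion E : Finset ρ) : Set ρ) = Set.range (v ∘ g) := by
        ext w
        simp only [Set.mem_image, Finset.mem_coe, Finset.mem_biUnion, Finset.mem_univ, true_and, hg,
          Finset.mem_singleton, Set.mem_range, Function.comp_apply]
        constructor
        · rintro ⟨y, ⟨i, rfl⟩, rfl⟩; exact ⟨i, rfl⟩
        · rintro ⟨i, rfl⟩; exact ⟨g i, ⟨i, rfl⟩, rfl⟩
      rw [hS] at hu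
      exact hu
    · push Not at hall
      obtain ⟨i, hi⟩ := hall
      -- `E i` is not empty (Rado's condition at `{i}`), hence has two distinct elements
      have hne0 : (E i).card ≠ 0 := by
        intro h0
        have h1 := hE {i}
        rw [Finset.card_singleton, Finset.singleton_biUnion, Finset.card_eq_zero.1 h0] at h1
        simp at h1
      have h2 : 1 < (E i).card := by omega
      obtain ⟨x₁, hx₁, x₂, hx₂, hne⟩ := Finset.one_lt_card.1 h2
      have hsum : ∀ x ∈ E i, ∑ j, (Function.update E i ((E i).erase x) j).card ≤ N := by
        intro x hx
        have : ∑ j, (Function.update E i ((E i).erase x) j).card + 1 = ∑ j, (E j).card := by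
          rw [← Finset.sum_erase_add _ _ (Finset.mem_univ i), ← Finset.sum_erase_add _ _ (Finset.mem_univ i),
            Function.update_self, add_assoc, Finset.card_erase_add_one hx]
          congr 1
          exact Finset.sum_congr rfl fun j hj => by rw [Function.update_of_ne (Finset.ne_of_mem_erase hj)]
        omega
      have hsub : ∀ x j, Function.update E i ((E i).erase x) j ⊆ E j := by
        intro x j
        by_cases hji : j = i
        · subst hji; rw [Function.update_self]; exact Finset.erase_subset _ _
        · rw [Function.update_of_ne hji]
      rcases rado_shrink v E hE i hx₁ hx₂ hne with hE' | hE'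
      · obtain ⟨g, hg, hli⟩ := ih _ (hsum x₁ hx₁) hE'
        exact ⟨g, fun j => hsub x₁ j (hg j), hli⟩
      · obtain ⟨g, hg, hli⟩ := ih _ (hsum x₂ hx₂) hE'
        exact ⟨g, fun j => hsub x₂ j (hg j), hli⟩

end DetLorentzian

end Summit.ValiantsHypothesis.ValiantsHypothesis.Theorems.LacunarySymmetroidMatrixDescartes
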